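import Summits.Parity.GeneralizedHardyLittlewood.Theorems.PrimeLevelFamEdgeMomentsBeyondDiagonalDiagRemTwoTwoInner
import Summits.Parity.GeneralizedHardyLittlewood.Theorems.PrimeLevelFamEdgeMomentsBeyondDiagonalDiagRemTwoTwoOuter
import Summits.Parity.GeneralizedHardyLittlewood.Theorems.PrimeLevelFamEdgeMomentsBeyondDiagonalDiagRemZeroTwoEstimate
import HarnessLib

/-!
# Route `PrimeLevelFamEdge`, crux K_A `MomentsBeyondDiagonal` (stmt-Parity-20007), line «petersson_layers» v4, stub `stub_diag`:
# **THE REMAINDER ESTIMATE (R₂₂) OF ORDER `(2,2)`, PROVED** (brick B5b — assembly)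

Last brick of (R₂₂): the hypothesis `hR₂₂` of `…DiagRungTwoOfR22.diagPart_asymp_of_natDegree_le_two_of_remainder` (p830190),
literally. Assembly exactly as for orders `(1,1)` / `(0,2)` (`…DiagRemEstimate`, `…DiagRemZeroTwoEstimate`):
`selbergRem_inner_eq₂₂` puts each `(c,g)` term in the coordinates of `…DiagRemTwoTwoInner.abs_inner_rem_le₂₂` (a factor
`W(cg)²`), `…DiagRemTwoTwoOuter.per_term_bound_gen` (weight `D²`, envelope `Λ¹²`, threshold `K₁ = ⌊q̂^{1/4}⌋` when admissible,
else `0`) and the `Σ_cΣ_g` bookkeeping `…DiagRemTwoTwoOuter.sum_sum_divWeightSq_div_mul(_sq)_le` + `final_arith₂₂` close it: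
`Λ¹²·(power saving) + Λ¹²·3Z₂²(2+log N)·4¹²/log¹²q̂ ≪ log q̂`.

* `selbergRem_inner_eq₂₂` — the (R₂₂) summand for fixed `(c,g)` is `W(cg)²` times the inner sum of `abs_inner_rem_le₂₂`;
* `remainder_estimate₂₂` — **(R₂₂): for every admissible `P` and every `Δ' ∈ (1, 3/2]` there are `C, q₀` with
  `|Sel_rem₂₂(q)| ≤ C·log q̂` for `q ≥ q₀`** — literally the hypothesis `hR₂₂`.

With `…DiagRungTwoOfR22` this makes RUNG `N = 2` of `stub_diag` (every `Q` of degree `≤ 2`, window `(1, 3/2]`)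
unconditional (corollary filed separately). Def-free; theorems only. Helper `--supports stmt-Parity-20007`; closes nothing
(`stub_diag` needs every rung; orders with `max(i,j) ≥ 3` and `stub_rung/core/band/identP` remain); K_A, K_B and the Parity
summit are NOT proved; nothing about Landau–Siegel zeros.

## References
* E. Kowalski, P. Michel, J. VanderKam, J. reine angew. Math. 526 (2000), (22)–(28) pp. 12–15 and Prop. 5.1 p. 18.
  [cite: KowalskiMichelVanderKam2000, (23)–(28) and Prop. 5.1 — derivation (order-(2,2) piece of the diagonal, general Q)]
-/

noncomputable section

open scoped Real ArithmeticFunction.Moebius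
open Finset ArithmeticFunction Polynomial Real MeasureTheory

namespace Summit.Parity.GeneralizedHardyLittlewood.Theorems.MomentsBeyondDiagonal.DiagCorner

open Literature.NumberTheory.LFunctions Literature.NumberTheory.LFunctions.KMV2000
open MollifierMainTerm (W)
open Literature.Barriers.Parity (Icc_one_eq_Ioc_zero)
open Summit.Parity.GeneralizedHardyLittlewood.Theorems.BeyondDiagonalBeatsQuarter.KernelFormXSq
  (copTauW copTauW_apply divWeight divWeight_nonneg one_le_divWeight abs_W_le)
open Summit.Parity.GeneralizedHardyLittlewood.Theorems.BeyondDiagonalBeatsQuarter.Corner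
open Summit.Parity.GeneralizedHardyLittlewood.Theorems.MomentsBeyondDiagonal.DiagKernel (coeff_zero_one_of_admissible)

/-! ### The (R₂₂) summand in the coordinates of `…DiagRemTwoTwoInner` -/

set_option maxHeartbeats 800000 in
-- large statement
/-- **The inner `(k₁,k₂)` sum of (R₂₂) for fixed `(c,g)` is `W(cg)²` times the sum of
`…DiagRemTwoTwoInner.abs_inner_rem_le₂₂`** (`τ(k)x′_{nk}/(nk) = W(n)a_n(k)P(ℓ⁺(k)/log M)`, `q̂²/(g²k₁k₂) = 1/(αk₁k₂)`,
`α = g²/q̂²`). [cite: KowalskiMichelVanderKam2000, (23) — derivation] -/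
theorem selbergRem_inner_eq₂₂ (P : ℝ[X]) {M Q : ℝ} (hM : 0 < M) (hQ : 0 < Q) {c g : ℕ} (hc : c ≠ 0) (hg : g ≠ 0)
    (E₀₀ E₀₁ E₁₀ E₀₂ E₂₀ E₁₁ E₁₂ E₂₁ E₂₂ μ₂ μ₄ : ℝ) :
    ∑ k₁ ∈ Icc 1 (⌊M⌋₊ / (c * g)), ∑ k₂ ∈ Icc 1 (⌊M⌋₊ / (c * g)),
      ((μ (c * g * k₁) : ℝ) * ((psi (c * g * k₁))⁻¹ *
          P.eval (Real.log (M / ((c * g * k₁ : ℕ) : ℝ)) / Real.log M)) / ((c * g * k₁ : ℕ) : ℝ)) *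
        ((μ (c * g * k₂) : ℝ) * ((psi (c * g * k₂))⁻¹ *
          P.eval (Real.log (M / ((c * g * k₂ : ℕ) : ℝ)) / Real.log M)) / ((c * g * k₂ : ℕ) : ℝ)) *
        ((k₁.divisors.card : ℝ) * (k₂.divisors.card : ℝ) *
          (((2 * (Real.log Q - Real.log g) - Real.log k₁ - Real.log k₂) ^ 4 -
        2 * (2 * (Real.log Q - Real.log g) - Real.log k₁ - Real.log k₂) ^ 2 *
          ((∑ p ∈ k₁.primeFactors, Real.log p ^ 2) + ∑ p ∈ k₂.primeFactors, Real.log p ^ 2) +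
        3 * ((∑ p ∈ k₁.primeFactors, Real.log p ^ 2) + ∑ p ∈ k₂.primeFactors, Real.log p ^ 2) ^ 2 -
        2 * ((∑ p ∈ k₁.primeFactors, Real.log p ^ 4) + ∑ p ∈ k₂.primeFactors, Real.log p ^ 4)) / 16 *
      ((∫ u₁ in Set.Ioi (0 : ℝ), ∫ u₂ in Set.Ioi ((((g * g * (k₁ * k₂) : ℕ) : ℝ) / Q ^ 2) / u₁),
              Real.exp (-(u₁ + u₂)) / (1 - Real.exp (-(u₁ + u₂))) ^ 2) -
            (Real.log (Q ^ 2 / ((g * g * (k₁ * k₂) : ℕ) : ℝ)) / 2 + E₀₀)) +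
    ((2 * (Real.log Q - Real.log g) - Real.log k₁ - Real.log k₂) ^ 3 -
        (2 * (Real.log Q - Real.log g) - Real.log k₁ - Real.log k₂) *
          ((∑ p ∈ k₁.primeFactors, Real.log p ^ 2) + ∑ p ∈ k₂.primeFactors, Real.log p ^ 2)) / 4 *
      (((∫ u₁ in Set.Ioi (0 : ℝ), ∫ u₂ in Set.Ioi ((((g * g * (k₁ * k₂) : ℕ) : ℝ) / Q ^ 2) / u₁),
              Real.exp (-(u₁ + u₂)) / (1 - Real.exp (-(u₁ + u₂))) ^ 2 * Real.log u₂) -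
            (-(Real.log (Q ^ 2 / ((g * g * (k₁ * k₂) : ℕ) : ℝ)) ^ 2) / 8 + E₀₁)) +
        ((∫ u₁ in Set.Ioi (0 : ℝ), Real.log u₁ * ∫ u₂ in Set.Ioi ((((g * g * (k₁ * k₂) : ℕ) : ℝ) / Q ^ 2) / u₁),
              Real.exp (-(u₁ + u₂)) / (1 - Real.exp (-(u₁ + u₂))) ^ 2) -
            (-(Real.log (Q ^ 2 / ((g * g * (k₁ * k₂) : ℕ) : ℝ)) ^ 2) / 8 + E₁₀))) +
    ((2 * (Real.log Q - Real.log g) - Real.log k₁ - Real.log k₂) ^ 2 +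
        ((∑ p ∈ k₁.primeFactors, Real.log p ^ 2) + ∑ p ∈ k₂.primeFactors, Real.log p ^ 2)) / 4 *
      (((∫ u₁ in Set.Ioi (0 : ℝ), ∫ u₂ in Set.Ioi ((((g * g * (k₁ * k₂) : ℕ) : ℝ) / Q ^ 2) / u₁),
              Real.exp (-(u₁ + u₂)) / (1 - Real.exp (-(u₁ + u₂))) ^ 2 * Real.log u₂ ^ 2) -
            (Real.log (Q ^ 2 / ((g * g * (k₁ * k₂) : ℕ) : ℝ)) ^ 3 / 24 + 2 * μ₂ * Real.log (Q ^ 2 / ((g * g * (k₁ * k₂) : ℕ) : ℝ)) + E₀₂)) +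
        ((∫ u₁ in Set.Ioi (0 : ℝ), Real.log u₁ ^ 2 * ∫ u₂ in Set.Ioi ((((g * g * (k₁ * k₂) : ℕ) : ℝ) / Q ^ 2) / u₁),
              Real.exp (-(u₁ + u₂)) / (1 - Real.exp (-(u₁ + u₂))) ^ 2) -
            (Real.log (Q ^ 2 / ((g * g * (k₁ * k₂) : ℕ) : ℝ)) ^ 3 / 24 + 2 * μ₂ * Real.log (Q ^ 2 / ((g * g * (k₁ * k₂) : ℕ) : ℝ)) + E₂₀))) +
    ((2 * (Real.log Q - Real.log g) - Real.log k₁ - Real.log k₂) ^ 2 -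
        ((∑ p ∈ k₁.primeFactors, Real.log p ^ 2) + ∑ p ∈ k₂.primeFactors, Real.log p ^ 2)) *
      ((∫ u₁ in Set.Ioi (0 : ℝ), Real.log u₁ * ∫ u₂ in Set.Ioi ((((g * g * (k₁ * k₂) : ℕ) : ℝ) / Q ^ 2) / u₁),
              Real.exp (-(u₁ + u₂)) / (1 - Real.exp (-(u₁ + u₂))) ^ 2 * Real.log u₂) -
            (Real.log (Q ^ 2 / ((g * g * (k₁ * k₂) : ℕ) : ℝ)) ^ 3 / 24 - 2 * μ₂ * Real.log (Q ^ 2 / ((g * g * (k₁ * k₂) : ℕ) : ℝ)) + E₁₁)) +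
    (2 * (Real.log Q - Real.log g) - Real.log k₁ - Real.log k₂) *
      (((∫ u₁ in Set.Ioi (0 : ℝ), Real.log u₁ * ∫ u₂ in Set.Ioi ((((g * g * (k₁ * k₂) : ℕ) : ℝ) / Q ^ 2) / u₁),
              Real.exp (-(u₁ + u₂)) / (1 - Real.exp (-(u₁ + u₂))) ^ 2 * Real.log u₂ ^ 2) -
            (-(Real.log (Q ^ 2 / ((g * g * (k₁ * k₂) : ℕ) : ℝ)) ^ 4) / 64 + μ₂ / 2 * Real.log (Q ^ 2 / ((g * g * (k₁ * k₂) : ℕ) : ℝ)) ^ 2 + E₁₂)) +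
        ((∫ u₁ in Set.Ioi (0 : ℝ), Real.log u₁ ^ 2 * ∫ u₂ in Set.Ioi ((((g * g * (k₁ * k₂) : ℕ) : ℝ) / Q ^ 2) / u₁),
              Real.exp (-(u₁ + u₂)) / (1 - Real.exp (-(u₁ + u₂))) ^ 2 * Real.log u₂) -
            (-(Real.log (Q ^ 2 / ((g * g * (k₁ * k₂) : ℕ) : ℝ)) ^ 4) / 64 + μ₂ / 2 * Real.log (Q ^ 2 / ((g * g * (k₁ * k₂) : ℕ) : ℝ)) ^ 2 + E₂₁))) +
    ((∫ u₁ in Set.Ioi (0 : ℝ), Real.log u₁ ^ 2 * ∫ u₂ in Set.Ioi ((((g * g * (k₁ * k₂) : ℕ) : ℝ) / Q ^ 2) / u₁),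
              Real.exp (-(u₁ + u₂)) / (1 - Real.exp (-(u₁ + u₂))) ^ 2 * Real.log u₂ ^ 2) -
            (Real.log (Q ^ 2 / ((g * g * (k₁ * k₂) : ℕ) : ℝ)) ^ 5 / 160 - μ₂ / 3 * Real.log (Q ^ 2 / ((g * g * (k₁ * k₂) : ℕ) : ℝ)) ^ 3 +
                    2 * μ₄ * Real.log (Q ^ 2 / ((g * g * (k₁ * k₂) : ℕ) : ℝ)) + E₂₂)))) =
    W (c * g) ^ 2 * ∑ k₁ ∈ Icc 1 ⌊M / ((c * g : ℕ) : ℝ)⌋₊, ∑ k₂ ∈ Icc 1 ⌊M / ((c * g : ℕ) : ℝ)⌋₊,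
      copTauW (c * g) k₁ * P.eval (ellp (M / ((c * g : ℕ) : ℝ)) k₁ / Real.log M) *
          (copTauW (c * g) k₂ * P.eval (ellp (M / ((c * g : ℕ) : ℝ)) k₂ / Real.log M)) *
        (((2 * (Real.log Q - Real.log g) - Real.log k₁ - Real.log k₂) ^ 4 -
        2 * (2 * (Real.log Q - Real.log g) - Real.log k₁ - Real.log k₂) ^ 2 *
          ((∑ p ∈ k₁.primeFactors, Real.log p ^ 2) + ∑ p ∈ k₂.primeFactors, Real.log p ^ 2) +
        3 * ((∑ p ∈ k₁.primeFactors, Real.log p ^ 2) + ∑ p ∈ k₂.primeFactors, Real.log p ^ 2) ^ 2 -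
        2 * ((∑ p ∈ k₁.primeFactors, Real.log p ^ 4) + ∑ p ∈ k₂.primeFactors, Real.log p ^ 4)) / 16 *
      ((∫ u₁ in Set.Ioi (0 : ℝ), ∫ u₂ in Set.Ioi (((g : ℝ) ^ 2 / Q ^ 2 * k₁ * k₂) / u₁),
              Real.exp (-(u₁ + u₂)) / (1 - Real.exp (-(u₁ + u₂))) ^ 2) -
            (Real.log (1 / ((g : ℝ) ^ 2 / Q ^ 2 * k₁ * k₂)) / 2 + E₀₀)) +
    ((2 * (Real.log Q - Real.log g) - Real.log k₁ - Real.log k₂) ^ 3 -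
        (2 * (Real.log Q - Real.log g) - Real.log k₁ - Real.log k₂) *
          ((∑ p ∈ k₁.primeFactors, Real.log p ^ 2) + ∑ p ∈ k₂.primeFactors, Real.log p ^ 2)) / 4 *
      (((∫ u₁ in Set.Ioi (0 : ℝ), ∫ u₂ in Set.Ioi (((g : ℝ) ^ 2 / Q ^ 2 * k₁ * k₂) / u₁),
              Real.exp (-(u₁ + u₂)) / (1 - Real.exp (-(u₁ + u₂))) ^ 2 * Real.log u₂) -
            (-(Real.log (1 / ((g : ℝ) ^ 2 / Q ^ 2 * k₁ * k₂)) ^ 2) / 8 + E₀₁)) +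
        ((∫ u₁ in Set.Ioi (0 : ℝ), Real.log u₁ * ∫ u₂ in Set.Ioi (((g : ℝ) ^ 2 / Q ^ 2 * k₁ * k₂) / u₁),
              Real.exp (-(u₁ + u₂)) / (1 - Real.exp (-(u₁ + u₂))) ^ 2) -
            (-(Real.log (1 / ((g : ℝ) ^ 2 / Q ^ 2 * k₁ * k₂)) ^ 2) / 8 + E₁₀))) +
    ((2 * (Real.log Q - Real.log g) - Real.log k₁ - Real.log k₂) ^ 2 +
        ((∑ p ∈ k₁.primeFactors, Real.log p ^ 2) + ∑ p ∈ k₂.primeFactors, Real.log p ^ 2)) / 4 *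
      (((∫ u₁ in Set.Ioi (0 : ℝ), ∫ u₂ in Set.Ioi (((g : ℝ) ^ 2 / Q ^ 2 * k₁ * k₂) / u₁),
              Real.exp (-(u₁ + u₂)) / (1 - Real.exp (-(u₁ + u₂))) ^ 2 * Real.log u₂ ^ 2) -
            (Real.log (1 / ((g : ℝ) ^ 2 / Q ^ 2 * k₁ * k₂)) ^ 3 / 24 + 2 * μ₂ * Real.log (1 / ((g : ℝ) ^ 2 / Q ^ 2 * k₁ * k₂)) + E₀₂)) +
        ((∫ u₁ in Set.Ioi (0 : ℝ), Real.log u₁ ^ 2 * ∫ u₂ in Set.Ioi (((g : ℝ) ^ 2 / Q ^ 2 * k₁ * k₂) / u₁),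
              Real.exp (-(u₁ + u₂)) / (1 - Real.exp (-(u₁ + u₂))) ^ 2) -
            (Real.log (1 / ((g : ℝ) ^ 2 / Q ^ 2 * k₁ * k₂)) ^ 3 / 24 + 2 * μ₂ * Real.log (1 / ((g : ℝ) ^ 2 / Q ^ 2 * k₁ * k₂)) + E₂₀))) +
    ((2 * (Real.log Q - Real.log g) - Real.log k₁ - Real.log k₂) ^ 2 -
        ((∑ p ∈ k₁.primeFactors, Real.log p ^ 2) + ∑ p ∈ k₂.primeFactors, Real.log p ^ 2)) *
      ((∫ u₁ in Set.Ioi (0 : ℝ), Real.log u₁ * ∫ u₂ in Set.Ioi (((g : ℝ) ^ 2 / Q ^ 2 * k₁ * k₂) / u₁),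
              Real.exp (-(u₁ + u₂)) / (1 - Real.exp (-(u₁ + u₂))) ^ 2 * Real.log u₂) -
            (Real.log (1 / ((g : ℝ) ^ 2 / Q ^ 2 * k₁ * k₂)) ^ 3 / 24 - 2 * μ₂ * Real.log (1 / ((g : ℝ) ^ 2 / Q ^ 2 * k₁ * k₂)) + E₁₁)) +
    (2 * (Real.log Q - Real.log g) - Real.log k₁ - Real.log k₂) *
      (((∫ u₁ in Set.Ioi (0 : ℝ), Real.log u₁ * ∫ u₂ in Set.Ioi (((g : ℝ) ^ 2 / Q ^ 2 * k₁ * k₂) / u₁),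
              Real.exp (-(u₁ + u₂)) / (1 - Real.exp (-(u₁ + u₂))) ^ 2 * Real.log u₂ ^ 2) -
            (-(Real.log (1 / ((g : ℝ) ^ 2 / Q ^ 2 * k₁ * k₂)) ^ 4) / 64 + μ₂ / 2 * Real.log (1 / ((g : ℝ) ^ 2 / Q ^ 2 * k₁ * k₂)) ^ 2 + E₁₂)) +
        ((∫ u₁ in Set.Ioi (0 : ℝ), Real.log u₁ ^ 2 * ∫ u₂ in Set.Ioi (((g : ℝ) ^ 2 / Q ^ 2 * k₁ * k₂) / u₁),
              Real.exp (-(u₁ + u₂)) / (1 - Real.exp (-(u₁ + u₂))) ^ 2 * Real.log u₂) -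
            (-(Real.log (1 / ((g : ℝ) ^ 2 / Q ^ 2 * k₁ * k₂)) ^ 4) / 64 + μ₂ / 2 * Real.log (1 / ((g : ℝ) ^ 2 / Q ^ 2 * k₁ * k₂)) ^ 2 + E₂₁))) +
    ((∫ u₁ in Set.Ioi (0 : ℝ), Real.log u₁ ^ 2 * ∫ u₂ in Set.Ioi (((g : ℝ) ^ 2 / Q ^ 2 * k₁ * k₂) / u₁),
              Real.exp (-(u₁ + u₂)) / (1 - Real.exp (-(u₁ + u₂))) ^ 2 * Real.log u₂ ^ 2) -
            (Real.log (1 / ((g : ℝ) ^ 2 / Q ^ 2 * k₁ * k₂)) ^ 5 / 160 - μ₂ / 3 * Real.log (1 / ((g : ℝ) ^ 2 / Q ^ 2 * k₁ * k₂)) ^ 3 +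
                    2 * μ₄ * Real.log (1 / ((g : ℝ) ^ 2 / Q ^ 2 * k₁ * k₂)) + E₂₂))) := by
  have hn : c * g ≠ 0 := mul_ne_zero hc hg
  have hY0 : 0 ≤ M / ((c * g : ℕ) : ℝ) := by positivity
  have hg0 : (0 : ℝ) < g := by exact_mod_cast Nat.pos_of_ne_zero hg
  rw [Nat.floor_div_natCast, Finset.mul_sum]
  refine Finset.sum_congr rfl fun k₁ hk₁ ↦ ?_
  rw [Finset.mul_sum]
  refine Finset.sum_congr rfl fun k₂ hk₂ ↦ ?_
  have hk₁0 : k₁ ≠ 0 := by have := (Finset.mem_Icc.1 hk₁).1; omega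
  have hk₂0 : k₂ ≠ 0 := by have := (Finset.mem_Icc.1 hk₂).1; omega
  have hk₁' : k₁ ∈ Icc 1 ⌊M / ((c * g : ℕ) : ℝ)⌋₊ := by rwa [Nat.floor_div_natCast]
  have hk₂' : k₂ ∈ Icc 1 ⌊M / ((c * g : ℕ) : ℝ)⌋₊ := by rwa [Nat.floor_div_natCast]
  have hk₁r : (0 : ℝ) < k₁ := by exact_mod_cast Nat.pos_of_ne_zero hk₁0
  have hk₂r : (0 : ℝ) < k₂ := by exact_mod_cast Nat.pos_of_ne_zero hk₂0
  rw [ellp_eq_log hY0 hk₁', ellp_eq_log hY0 hk₂']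
  have hy : (((g * g * (k₁ * k₂) : ℕ) : ℝ) / Q ^ 2) = (g : ℝ) ^ 2 / Q ^ 2 * k₁ * k₂ := by
    push_cast; ring
  have hlg : Real.log (Q ^ 2 / ((g * g * (k₁ * k₂) : ℕ) : ℝ)) = Real.log (1 / ((g : ℝ) ^ 2 / Q ^ 2 * k₁ * k₂)) := by
    congr 1
    push_cast
    field_simp
  simp only [hy, hlg]
  exact prefactor_aux (tau_mul_xP_div P M hn hk₁0) (tau_mul_xP_div P M hn hk₂0)

/-! ### (R₂₂) -/

set_option maxHeartbeats 1600000 in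
-- large statement and assembly
/-- **THE REMAINDER ESTIMATE (R₂₂) OF ORDER `(2,2)`** (window `(1, 3/2]`): the hypothesis `hR₂₂` of
`…DiagRungTwoOfR22.diagPart_asymp_of_natDegree_le_two_of_remainder`, proved.
[cite: KowalskiMichelVanderKam2000, (23)–(28) and Prop. 5.1 — derivation (order-(2,2) piece of the diagonal, general Q)] -/
theorem remainder_estimate₂₂ :
    ∃ E₀₀ E₀₁ E₁₀ E₀₂ E₂₀ E₁₁ E₁₂ E₂₁ E₂₂ μ₂ μ₄ : ℝ, ∀ P : ℝ[X], KMV2000.Admissible P → ∀ Δ' : ℝ, 1 < Δ' → Δ' ≤ 3 / 2 →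
      ∃ C : ℝ, ∃ q₀ : ℕ, ∀ (q : ℕ) [NeZero q], q₀ ≤ q →
        |∑ c ∈ Icc 1 ⌊qhat q ^ Δ'⌋₊, ∑ g ∈ Icc 1 (⌊qhat q ^ Δ'⌋₊ / c), (μ g : ℝ) * c *
        ∑ k₁ ∈ Icc 1 (⌊qhat q ^ Δ'⌋₊ / (c * g)), ∑ k₂ ∈ Icc 1 (⌊qhat q ^ Δ'⌋₊ / (c * g)),
          ((μ (c * g * k₁) : ℝ) * ((psi (c * g * k₁))⁻¹ *
              P.eval (Real.log (qhat q ^ Δ' / ((c * g * k₁ : ℕ) : ℝ)) / Real.log (qhat q ^ Δ'))) / ((c * g * k₁ : ℕ) : ℝ)) *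
            ((μ (c * g * k₂) : ℝ) * ((psi (c * g * k₂))⁻¹ *
              P.eval (Real.log (qhat q ^ Δ' / ((c * g * k₂ : ℕ) : ℝ)) / Real.log (qhat q ^ Δ'))) / ((c * g * k₂ : ℕ) : ℝ)) *
            ((k₁.divisors.card : ℝ) * (k₂.divisors.card : ℝ) *
              (((2 * (Real.log (qhat q) - Real.log g) - Real.log k₁ - Real.log k₂) ^ 4 -
        2 * (2 * (Real.log (qhat q) - Real.log g) - Real.log k₁ - Real.log k₂) ^ 2 *
          ((∑ p ∈ k₁.primeFactors, Real.log p ^ 2) + ∑ p ∈ k₂.primeFactors, Real.log p ^ 2) +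
        3 * ((∑ p ∈ k₁.primeFactors, Real.log p ^ 2) + ∑ p ∈ k₂.primeFactors, Real.log p ^ 2) ^ 2 -
        2 * ((∑ p ∈ k₁.primeFactors, Real.log p ^ 4) + ∑ p ∈ k₂.primeFactors, Real.log p ^ 4)) / 16 *
      ((∫ u₁ in Set.Ioi (0 : ℝ), ∫ u₂ in Set.Ioi ((((g * g * (k₁ * k₂) : ℕ) : ℝ) / qhat q ^ 2) / u₁),
              Real.exp (-(u₁ + u₂)) / (1 - Real.exp (-(u₁ + u₂))) ^ 2) -
            (Real.log (qhat q ^ 2 / ((g * g * (k₁ * k₂) : ℕ) : ℝ)) / 2 + E₀₀)) +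
    ((2 * (Real.log (qhat q) - Real.log g) - Real.log k₁ - Real.log k₂) ^ 3 -
        (2 * (Real.log (qhat q) - Real.log g) - Real.log k₁ - Real.log k₂) *
          ((∑ p ∈ k₁.primeFactors, Real.log p ^ 2) + ∑ p ∈ k₂.primeFactors, Real.log p ^ 2)) / 4 *
      (((∫ u₁ in Set.Ioi (0 : ℝ), ∫ u₂ in Set.Ioi ((((g * g * (k₁ * k₂) : ℕ) : ℝ) / qhat q ^ 2) / u₁),
              Real.exp (-(u₁ + u₂)) / (1 - Real.exp (-(u₁ + u₂))) ^ 2 * Real.log u₂) -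
            (-(Real.log (qhat q ^ 2 / ((g * g * (k₁ * k₂) : ℕ) : ℝ)) ^ 2) / 8 + E₀₁)) +
        ((∫ u₁ in Set.Ioi (0 : ℝ), Real.log u₁ * ∫ u₂ in Set.Ioi ((((g * g * (k₁ * k₂) : ℕ) : ℝ) / qhat q ^ 2) / u₁),
              Real.exp (-(u₁ + u₂)) / (1 - Real.exp (-(u₁ + u₂))) ^ 2) -
            (-(Real.log (qhat q ^ 2 / ((g * g * (k₁ * k₂) : ℕ) : ℝ)) ^ 2) / 8 + E₁₀))) +
    ((2 * (Real.log (qhat q) - Real.log g) - Real.log k₁ - Real.log k₂) ^ 2 +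
        ((∑ p ∈ k₁.primeFactors, Real.log p ^ 2) + ∑ p ∈ k₂.primeFactors, Real.log p ^ 2)) / 4 *
      (((∫ u₁ in Set.Ioi (0 : ℝ), ∫ u₂ in Set.Ioi ((((g * g * (k₁ * k₂) : ℕ) : ℝ) / qhat q ^ 2) / u₁),
              Real.exp (-(u₁ + u₂)) / (1 - Real.exp (-(u₁ + u₂))) ^ 2 * Real.log u₂ ^ 2) -
            (Real.log (qhat q ^ 2 / ((g * g * (k₁ * k₂) : ℕ) : ℝ)) ^ 3 / 24 + 2 * μ₂ * Real.log (qhat q ^ 2 / ((g * g * (k₁ * k₂) : ℕ) : ℝ)) + E₀₂)) +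
        ((∫ u₁ in Set.Ioi (0 : ℝ), Real.log u₁ ^ 2 * ∫ u₂ in Set.Ioi ((((g * g * (k₁ * k₂) : ℕ) : ℝ) / qhat q ^ 2) / u₁),
              Real.exp (-(u₁ + u₂)) / (1 - Real.exp (-(u₁ + u₂))) ^ 2) -
            (Real.log (qhat q ^ 2 / ((g * g * (k₁ * k₂) : ℕ) : ℝ)) ^ 3 / 24 + 2 * μ₂ * Real.log (qhat q ^ 2 / ((g * g * (k₁ * k₂) : ℕ) : ℝ)) + E₂₀))) +
    ((2 * (Real.log (qhat q) - Real.log g) - Real.log k₁ - Real.log k₂) ^ 2 -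
        ((∑ p ∈ k₁.primeFactors, Real.log p ^ 2) + ∑ p ∈ k₂.primeFactors, Real.log p ^ 2)) *
      ((∫ u₁ in Set.Ioi (0 : ℝ), Real.log u₁ * ∫ u₂ in Set.Ioi ((((g * g * (k₁ * k₂) : ℕ) : ℝ) / qhat q ^ 2) / u₁),
              Real.exp (-(u₁ + u₂)) / (1 - Real.exp (-(u₁ + u₂))) ^ 2 * Real.log u₂) -
            (Real.log (qhat q ^ 2 / ((g * g * (k₁ * k₂) : ℕ) : ℝ)) ^ 3 / 24 - 2 * μ₂ * Real.log (qhat q ^ 2 / ((g * g * (k₁ * k₂) : ℕ) : ℝ)) + E₁₁)) +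
    (2 * (Real.log (qhat q) - Real.log g) - Real.log k₁ - Real.log k₂) *
      (((∫ u₁ in Set.Ioi (0 : ℝ), Real.log u₁ * ∫ u₂ in Set.Ioi ((((g * g * (k₁ * k₂) : ℕ) : ℝ) / qhat q ^ 2) / u₁),
              Real.exp (-(u₁ + u₂)) / (1 - Real.exp (-(u₁ + u₂))) ^ 2 * Real.log u₂ ^ 2) -
            (-(Real.log (qhat q ^ 2 / ((g * g * (k₁ * k₂) : ℕ) : ℝ)) ^ 4) / 64 + μ₂ / 2 * Real.log (qhat q ^ 2 / ((g * g * (k₁ * k₂) : ℕ) : ℝ)) ^ 2 + E₁₂)) +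
        ((∫ u₁ in Set.Ioi (0 : ℝ), Real.log u₁ ^ 2 * ∫ u₂ in Set.Ioi ((((g * g * (k₁ * k₂) : ℕ) : ℝ) / qhat q ^ 2) / u₁),
              Real.exp (-(u₁ + u₂)) / (1 - Real.exp (-(u₁ + u₂))) ^ 2 * Real.log u₂) -
            (-(Real.log (qhat q ^ 2 / ((g * g * (k₁ * k₂) : ℕ) : ℝ)) ^ 4) / 64 + μ₂ / 2 * Real.log (qhat q ^ 2 / ((g * g * (k₁ * k₂) : ℕ) : ℝ)) ^ 2 + E₂₁))) +
    ((∫ u₁ in Set.Ioi (0 : ℝ), Real.log u₁ ^ 2 * ∫ u₂ in Set.Ioi ((((g * g * (k₁ * k₂) : ℕ) : ℝ) / qhat q ^ 2) / u₁),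
              Real.exp (-(u₁ + u₂)) / (1 - Real.exp (-(u₁ + u₂))) ^ 2 * Real.log u₂ ^ 2) -
            (Real.log (qhat q ^ 2 / ((g * g * (k₁ * k₂) : ℕ) : ℝ)) ^ 5 / 160 - μ₂ / 3 * Real.log (qhat q ^ 2 / ((g * g * (k₁ * k₂) : ℕ) : ℝ)) ^ 3 +
                    2 * μ₄ * Real.log (qhat q ^ 2 / ((g * g * (k₁ * k₂) : ℕ) : ℝ)) + E₂₂))))| ≤
          C * Real.log (qhat q) := by
  obtain ⟨E₀₀, E₀₁, E₁₀, E₀₂, E₂₀, E₁₁, E₁₂, E₂₁, E₂₂, μ₂, μ₄, hin⟩ := abs_inner_rem_le₂₂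
  refine ⟨E₀₀, E₀₁, E₁₀, E₀₂, E₂₀, E₁₁, E₁₂, E₂₁, E₂₂, μ₂, μ₄, fun P hP Δ' h1 h32 ↦ ?_⟩
  obtain ⟨hP0, -⟩ := coeff_zero_one_of_admissible hP
  obtain ⟨Cin, hCin, hI⟩ := hin P hP0
  obtain ⟨C₈, hC₈, hC₈b⟩ := rpow_neg_le_div_log_pow (show (0 : ℝ) < 1 / 8 by norm_num) 15
  set Z₂ : ℝ := (∑' d : ℕ, (d : ℝ) ^ (-(5 / 4 : ℝ))) ^ 2 with hZ₂
  have hZ₂0 : 0 ≤ Z₂ := sq_nonneg _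
  obtain ⟨q₃, hq₃⟩ := exists_log_qhat_ge (2 : ℝ)
  refine ⟨Cin * (Z₂ ^ 2 * (16 * 5 ^ 14 * C₈ + 6 * 4 ^ 12 * 5 ^ 13)), q₃, fun q _ hq ↦ ?_⟩
  -- the level
  have hl2 : (2 : ℝ) ≤ Real.log (qhat q) := hq₃ q hq
  set Q : ℝ := qhat q with hQdef
  have hQ0' : 0 ≤ Q := by rw [hQdef]; unfold qhat; positivity
  have hQ : 0 < Q := lt_of_le_of_ne hQ0' fun h0 ↦ by rw [← h0, Real.log_zero] at hl2; linarith
  have hQ3 : 3 ≤ Q := by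
    have := Real.add_one_le_exp (Real.log Q)
    rw [Real.exp_log hQ] at this
    linarith
  have hQ1 : 1 ≤ Q := by linarith
  have hQ2 : 2 ≤ Q := by linarith
  set LQ : ℝ := Real.log Q with hLQdef
  have hLQ1 : 1 ≤ LQ := by linarith
  -- the mollifier length
  set M : ℝ := Q ^ Δ' with hMdef
  have hMQ : Q ≤ M := by rw [hMdef]; exact Real.self_le_rpow_of_one_le hQ1 h1.le
  have hM2 : 2 ≤ M := by linarith
  have hM1 : 1 ≤ M := by linarith
  have hM0 : 0 < M := by linarith
  have hM32 : M ≤ Q ^ (3 / 2 : ℝ) := Real.rpow_le_rpow_of_exponent_le hQ1 h32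
  have hlogM : Real.log M = Δ' * LQ := by rw [hMdef, hLQdef]; exact Real.log_rpow hQ Δ'
  have hlogM0 : 0 ≤ Real.log M := Real.log_nonneg hM1
  set Lam : ℝ := 1 + 2 * Real.log M + Real.log Q with hLamdef
  have hLam1 : 1 ≤ Lam := by rw [hLamdef]; linarith
  have hLam5 : Lam ≤ 5 * LQ := by
    rw [hLamdef, hlogM]
    have : Δ' * LQ ≤ 3 / 2 * LQ := mul_le_mul_of_nonneg_right h32 (by linarith)
    rw [← hLQdef]; linarith
  set N : ℕ := ⌊M⌋₊ with hNdef
  have hN1 : 1 ≤ N := Nat.le_floor (by simpa using hM1)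
  have hNM : (N : ℝ) ≤ M := Nat.floor_le hM0.le
  have hN0 : (0 : ℝ) < N := by exact_mod_cast hN1
  have hlogN0 : 0 ≤ Real.log (N : ℝ) := Real.log_nonneg (by exact_mod_cast hN1)
  have hlogN : Real.log (N : ℝ) ≤ Real.log M := Real.log_le_log hN0 hNM
  have h1lN : 1 + Real.log (N : ℝ) ≤ Lam := by
    rw [hLamdef]; have : 0 ≤ Real.log Q := by rw [← hLQdef]; linarith
    linarith
  have h2lN : 2 + Real.log (N : ℝ) ≤ 2 * Lam := by linarith
  have hLam12 : 0 ≤ Lam ^ 12 := by positivity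
  -- the threshold `K₁ = ⌊Q^{1/4}⌋`
  obtain ⟨hK1, hKQ, hKlog⟩ := floor_rpow_facts hQ1 (show (0 : ℝ) < 1 / 4 by norm_num)
  set K₁ : ℕ := ⌊Q ^ (1 / 4 : ℝ)⌋₊ with hK₁def
  have hK0 : (0 : ℝ) ≤ K₁ := Nat.cast_nonneg _
  have hlogK0 : 0 ≤ Real.log (K₁ : ℝ) := Real.log_natCast_nonneg K₁
  -- the power savings `A₁ ≤ 4C₈/(1+LQ)¹⁵`
  have hKM : (K₁ : ℝ) * M ≤ Q ^ (1 / 4 : ℝ) * Q ^ (3 / 2 : ℝ) := mul_le_mul hKQ hM32 hM0.le (by positivity)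
  have hQ8 : Q ^ (-(1 / 8 : ℝ)) ≤ C₈ / (1 + LQ) ^ 15 := hC₈b Q hQ1
  have hQ80 : 0 ≤ Q ^ (-(1 / 8 : ℝ)) := by positivity
  have hb1 : Real.sqrt (2 * K₁ * M) / Q ≤ Real.sqrt 2 * Q ^ (-(1 / 8 : ℝ)) := by
    have hsq : (Q ^ (7 / 8 : ℝ)) ^ 2 = Q ^ (1 / 4 : ℝ) * Q ^ (3 / 2 : ℝ) := by
      rw [← Real.rpow_natCast, ← Real.rpow_mul hQ.le, ← Real.rpow_add hQ]
      congr 1; norm_num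
    have h1' : 2 * (K₁ : ℝ) * M ≤ 2 * (Q ^ (7 / 8 : ℝ)) ^ 2 := by rw [hsq]; linarith
    have h2' : Real.sqrt (2 * K₁ * M) ≤ Real.sqrt 2 * Q ^ (7 / 8 : ℝ) := by
      calc Real.sqrt (2 * K₁ * M) ≤ Real.sqrt (2 * (Q ^ (7 / 8 : ℝ)) ^ 2) := Real.sqrt_le_sqrt h1'
        _ = Real.sqrt 2 * Q ^ (7 / 8 : ℝ) := by rw [Real.sqrt_mul (by norm_num), Real.sqrt_sq (by positivity)]
    rw [div_le_iff₀ hQ]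
    refine h2'.trans (le_of_eq ?_)
    rw [mul_assoc, ← Real.rpow_add_one hQ.ne']
    congr 1; norm_num
  have hb2 : 2 * K₁ * M / Q ^ 2 ≤ 2 * Q ^ (-(1 / 8 : ℝ)) := by
    have h74 : Q ^ (1 / 4 : ℝ) * Q ^ (3 / 2 : ℝ) = Q ^ (-(1 / 4) : ℝ) * Q ^ 2 := by
      rw [← Real.rpow_add hQ, show (1 / 4 : ℝ) + 3 / 2 = -(1 / 4) + 2 by norm_num, Real.rpow_add hQ, Real.rpow_two]
    have hKM' : (K₁ : ℝ) * M ≤ Q ^ (-(1 / 4) : ℝ) * Q ^ 2 := h74 ▸ hKM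
    have h48 : Q ^ (-(1 / 4) : ℝ) ≤ Q ^ (-(1 / 8 : ℝ)) := Real.rpow_le_rpow_of_exponent_le hQ1 (by norm_num)
    rw [div_le_iff₀ (by positivity)]
    nlinarith [sq_nonneg Q]
  have hs2 : Real.sqrt 2 ≤ 2 := by
    have := Real.sq_sqrt (show (0 : ℝ) ≤ 2 by norm_num)
    nlinarith [Real.sqrt_nonneg 2]
  have hA₁0 : 0 ≤ Real.sqrt (2 * K₁ * M) / Q + 2 * K₁ * M / Q ^ 2 := by positivity
  have hA₁ : Real.sqrt (2 * K₁ * M) / Q + 2 * K₁ * M / Q ^ 2 ≤ 4 * C₈ / (1 + LQ) ^ 15 := by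
    calc _ ≤ Real.sqrt 2 * Q ^ (-(1 / 8 : ℝ)) + 2 * Q ^ (-(1 / 8 : ℝ)) := add_le_add hb1 hb2
      _ ≤ 2 * Q ^ (-(1 / 8 : ℝ)) + 2 * Q ^ (-(1 / 8 : ℝ)) := by gcongr
      _ = 4 * Q ^ (-(1 / 8 : ℝ)) := by ring
      _ ≤ 4 * (C₈ / (1 + LQ) ^ 15) := by gcongr
      _ = 4 * C₈ / (1 + LQ) ^ 15 := by ring
  -- the log saving `A₂ ≤ 4¹²/LQ¹²`
  have hA₂0 : 0 ≤ 1 / (1 + Real.log (K₁ : ℝ)) ^ 12 := by positivity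
  have hA₂ : 1 / (1 + Real.log (K₁ : ℝ)) ^ 12 ≤ 4 ^ 12 / LQ ^ 12 := by
    have hx : LQ ≤ 4 * (1 + Real.log (K₁ : ℝ)) := by rw [hLQdef]; linarith
    have hx12 : LQ ^ 12 ≤ (4 * (1 + Real.log (K₁ : ℝ))) ^ 12 := pow_le_pow_left₀ (by linarith) hx 12
    rw [div_le_div_iff₀ (by positivity) (by positivity), one_mul, mul_pow] at *
    linarith
  -- the per-term input
  have hF := fun (n g : ℕ) (hn : n ≠ 0) (hg : g ≠ 0) (hnM : (n : ℝ) ≤ M) (hgM : (g : ℝ) ≤ M) (K : ℕ)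
      (hK : 2 * ((g : ℝ) ^ 2 / Q ^ 2) * K * (M / n) ≤ 1) ↦ hI n g hn hg Q M hQ2 hM2 hnM hgM K hK
  -- rewrite the inner sums and bound termwise
  rw [Finset.sum_congr rfl fun c hc ↦ Finset.sum_congr rfl fun g hg ↦ by
    rw [selbergRem_inner_eq₂₂ P hM0 hQ (c := c) (g := g)
      (by have := (Finset.mem_Icc.1 hc).1; omega) (by have := (Finset.mem_Icc.1 hg).1; omega)
      E₀₀ E₀₁ E₁₀ E₀₂ E₂₀ E₁₁ E₁₂ E₂₁ E₂₂ μ₂ μ₄]]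
  have hterm := fun c (hc : c ∈ Icc 1 N) g (hg : g ∈ Icc 1 (N / c)) ↦
    per_term_bound_gen (w := fun n ↦ divWeight n ^ 2) (E := Lam ^ 12) hCin.le hLam12 (fun n ↦ sq_nonneg _) hQ hM1
      hF K₁ hc hg
  calc _ ≤ ∑ c ∈ Icc 1 N, ∑ g ∈ Icc 1 (N / c),
        Cin * Lam ^ 12 * (divWeight (c * g) ^ 2 / ((c : ℝ) * g) * (Real.sqrt (2 * K₁ * M) / Q + 2 * K₁ * M / Q ^ 2) +
          divWeight (c * g) ^ 2 / ((c : ℝ) * g ^ 2) * (1 / (1 + Real.log K₁) ^ 12)) := by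
        refine (Finset.abs_sum_le_sum_abs _ _).trans (Finset.sum_le_sum fun c hc ↦ ?_)
        exact (Finset.abs_sum_le_sum_abs _ _).trans (Finset.sum_le_sum fun g hg ↦ hterm c hc g hg)
    _ = Cin * Lam ^ 12 * ((∑ c ∈ Icc 1 N, ∑ g ∈ Icc 1 (N / c), divWeight (c * g) ^ 2 / ((c : ℝ) * g)) *
            (Real.sqrt (2 * K₁ * M) / Q + 2 * K₁ * M / Q ^ 2) +
          (∑ c ∈ Icc 1 N, ∑ g ∈ Icc 1 (N / c), divWeight (c * g) ^ 2 / ((c : ℝ) * g ^ 2)) *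
            (1 / (1 + Real.log K₁) ^ 12)) := by
        rw [Finset.sum_mul, Finset.sum_mul, ← Finset.sum_add_distrib, Finset.mul_sum]
        refine Finset.sum_congr rfl fun c _ ↦ ?_
        rw [Finset.sum_mul, Finset.sum_mul, ← Finset.sum_add_distrib, Finset.mul_sum]
    _ ≤ Cin * Lam ^ 12 * ((Z₂ * (2 + Real.log N)) ^ 2 * (Real.sqrt (2 * K₁ * M) / Q + 2 * K₁ * M / Q ^ 2) +
          3 * Z₂ ^ 2 * (2 + Real.log N) * (1 / (1 + Real.log K₁) ^ 12)) := by
        have hCL : 0 ≤ Cin * Lam ^ 12 := by positivity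
        apply mul_le_mul_of_nonneg_left _ hCL
        exact add_le_add (mul_le_mul_of_nonneg_right (sum_sum_divWeightSq_div_mul_le hN1) hA₁0)
          (mul_le_mul_of_nonneg_right (sum_sum_divWeightSq_div_mul_sq_le hN1) hA₂0)
    _ ≤ Cin * (Z₂ ^ 2 * (16 * 5 ^ 14 * C₈ + 6 * 4 ^ 12 * 5 ^ 13)) * LQ :=
        final_arith₂₂ hCin.le hC₈.le hLQ1 hLam1 hLam5 hlogN0 h2lN hA₁0 hA₁ hA₂0 hA₂

end Summit.Parity.GeneralizedHardyLittlewood.Theorems.MomentsBeyondDiagonal.DiagCorner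

end
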